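import Summits.BirchSwinnertonDyer.Rank1Residual.Additive.GordRankOneKatoCertificateThree
import Summits.BirchSwinnertonDyer.Rank1Residual.Additive.GordRankOneKatoCertificateBSD
import HarnessLib

/-!
# O7-ord at `p = 3` on the (G)-ordinary defect-`2` rows, analytic rank ONE: `BSD(E,3) ⟺
# ord₃ q + ord₃ Reg₃(E,Dh) = 1` from Kato's divisibility on the `ω`-branch of `E ⊗ χ_{−3}` + ONE
# `3`-adic unit, everything else PUBLISHED (cell `b2b-bsdres`, team n1011, seat p12 (gen 2), OWNERS
# row T-O7K3, file 2; sequel of `GordRankOneKatoCertificateThree.lean` over additive-p2 gen 19's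
# cell-agnostic cores of `GordRankOneKatoCertificateBSD.lean`, input of record R5-4)

HONEST FRAMING (cell `b2b-bsdres`, run/shared/lean/b2b/bsd-rank1-residual/, verbatim in every
file): the goal of the cell is to DELETE the COMBINATION-SHAPED residual classes of the
Birch–Swinnerton-Dyer formula for ALL analytic-rank `≤ 1` elliptic curves over `ℚ` — "full BSD
formula for every rank `≤ 1` curve in class `C`" assembled STRICTLY from published theorems — so
that the rank-`≤ 1` remainder becomes exactly the CONSTRUCTION-SHAPED classes, which are TYPED
(missing-input `Prop`s), NOT attempted. This is not "finishing BSD". Team n1011 (RESIDUAL-MAP §I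
O7, O7-ord at `p = 3`), seat `b2b-bsdres-n1011-p12` (gen 2), row T-O7K3: research route on the
CONSTRUCTION-SHAPED class O7; labels and marks UNCHANGED; nothing booked; NO Literature fact minted;
no definition. THEOREMS ONLY; named facts are HYPOTHESES (`hK` Kato 2004 Thm. 17.4 (3) semistable
big-image half-eigenspace reading; `hWu` Wuthrich 2014 Thm. 16; `hDel3` = `Delbourgo2002.mainTheorem_three`;
`hGZK`; `hmod`/`hmodD`) — NO `hPal` anywhere (at `p = 3` the branch is the MINUS one and Birch's
formula for `d = −3 < 0` is a tree theorem); the per-pair inputs are additive-p2's typed certificate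
`BranchUnitCertificateAt W 3` (resp. ONE `3`-adic unit `hone`), a (B)-datum `hB`, the rational `q` of
`L'(E,1) = q·Ω_E·Reg_∞(E)`, and the decidable row binders `hna` (`a₃(E^{(−3)}) ∉ {1, −2}` on these
rows — seat p10's REVIEW-T-O7K3-BINDERS B5/B6, kept as the tree predicate `ReductionNonAnomalous W 3`)
and `hcm` (`j ∉` the 13 CM values).

## What and why (seat p10's recipe T1–T6, `cells/n1011/…/REVIEW-T-O7K3-BINDERS.md`)

* §1 `he`-FREE class core at `3`: on an additive (G)-ordinary pair at `3` the defect is `2`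
  AUTOMATICALLY (`semistabilityIndex_eq_two_of_typeG_three`), so file 1's odd-`p` theorem reads
  `ClassX4Gord.isTorsion_and_mu_zero_lam_le_one_three_of_katoHalf_of_cert (hX : ClassX4Gord W 3)
  (hsurj : Surj W 3) (hcert)` — no `he`, no tower binder (p14's tower theorem inside).
* §2 with GZK (`r_an = 1`): additive-p2's cell-agnostic core
  `schneider_and_padicVal_identity_rankOne_of_mu_zero_lam_le_one (p ≠ 2)` gives Schneider's
  `Reg₃(E,Dh) ≠ 0` for every (B)-datum and the exact identity
  `ord₃ #Ш(E) + ord₃ Reg₃(E,Dh) + ord₃ ∏c_ℓ + ord₃ ℓ = 1 + 2·ord₃ #E(ℚ)_tors` (`ℓ ∣ 9`, `= 1` off the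
  anomalous rows) — `ClassX4Gord.schneider_and_padicVal_identity_three_of_katoHalf_of_cert`, X3 twin;
  and their bookkeeping `bsdp_iff_padicValRat_add_eq_one` gives **`BSD(E,3) ⟺ ord₃ q + ord₃ Reg₃ = 1`**
  on the non-anomalous rows — `ClassX4Gord.bsdp_three_iff_padicVal_rankOne_of_katoHalf_of_cert`, X3
  twin `ClassX3Gord.…_of_wuthrichHalf_of_cert`; the (B)-datum SUPPLIED by `hDel3` (¬CM):
  `ClassX4Gord.exists_leadingTermClauses_and_schneider_three_of_katoHalf_of_cert`.
* §3 the certificate from ONE number WITHOUT Pal (`p ≡ 3 (mod 4)` arm of additive-p2's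
  `constantCoeff_branch_eq_zero_of_entireLFunction_one_eq_zero`, whose even arm alone needs `hPal`):
  `constantCoeff_branch_eq_zero_of_entireLFunction_one_eq_zero_odd`,
  `branchUnitCertificateAt_of_norm_coeff_one_odd`, and the `p = 3` HEADLINE
  `ClassX4Gord.bsdp_three_iff_padicVal_rankOne_of_katoHalf_of_norm_coeff_one`: on O7-ord@3 ∩
  X4♯(G-ord) ∩ surj(3) ∩ non-CM ∩ non-anomalous, `BSD(E,3) ⟺ ord₃ q + ord₃ Reg₃(E,Dh) = 1` GIVEN Kato's
  divisibility and ONE `3`-adic unit — the linear coefficient of the Néron-normalised `ω¹`-branch of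
  the Mazur–Tate–Teitelbaum series of `E ⊗ χ_{−3}` (instrument note, p10 B10: Sage
  `E.quadratic_twist(-3).minimal_model().padic_lseries(3).series(n, eta=1)`, NOT a `D`-twist call).

T-O7K3 needs NO conjecture node: per pair the residue is numerical — one `3`-adic unit, one regulator
valuation (flag `Del02-height-normalisation`: the number fed in must be Delbourgo's `⟨,⟩_{3,ℚ}`-regulator
of a (B)-datum; the kernel statements quantify `Dh` under `LeadingTermClauses W 3 Dh`), `ord₃ q`.
Nothing booked; O7 stays CONSTRUCTION-SHAPED.

References: [Kato2004Asterisque] Thm. 17.4 (3); [Wuthrich2014] Thm. 16, Lemma 20; [Delbourgo2002]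
Thm. (A), (B) (p. 40); [MazurTateTeitelbaum1986Invent] §I.13–I.14; [Miller2011LMS] Def. 1.1;
[Washington1997] §7.1.
-/

noncomputable section

open scoped Classical MatrixGroups ModularForm NumberField

namespace Summit.BirchSwinnertonDyer.Rank1Residual.Additive

open CongruenceSubgroup WeierstrassCurve NumberField Literature.NumberTheory.EllipticCurves
  Literature.NumberTheory.EllipticCurves.ModularForms
  Literature.NumberTheory.EllipticCurves.Rank1Residual
  Literature.NumberTheory.EllipticCurves.Rank1Residual.Typed
  Literature.NumberTheory.EllipticCurves.Delbourgo2002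
  Literature.NumberTheory.GaloisRepresentations Summit.BirchSwinnertonDyer.Rank1Residual.AdditivePotMult
  Summit.BirchSwinnertonDyer.Rank1Residual.X1.MuLambda
  Summit.BirchSwinnertonDyer.Rank1Residual.X1.RankOneParitySqueeze
  IsDedekindDomain

/-! ### §1 `p = 3`: the class core WITHOUT the defect hypothesis (`e = 2` is automatic at `3`) -/

section Three

variable {W : WeierstrassCurve ℚ} [W.IsElliptic] [W.IsGloballyMinimal] [hp : Fact (Nat.Prime 3)]

/-- **X4♯(G-ord)@3 ∩ {`ρ̄_{E,3}` onto}: Kato's divisibility + the one-number certificate ⟹ `X` torsion,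
`μ(fE) = 0`, `λ(fE) ≤ 1`** — file 1's odd-`p` theorem at `p = 3`, with the defect `e = 2` derived
(`semistabilityIndex_eq_two_of_typeG_three`: an additive (G)-ordinary pair at `3` is Kodaira `I₀*`).
[cite: Kato2004Asterisque, Thm. 17.4 (3) (p. 273)] [cite: Wuthrich2014, Lemma 20 (p. 399)] -/
theorem ClassX4Gord.isTorsion_and_mu_zero_lam_le_one_three_of_katoHalf_of_cert
    (hK : Wuthrich2014.kato_halfEigenCharIdeal_dvd_cyclotomicPrime_of_surjective)
    (hmodD : nonempty_modularParametrizationData)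
    (hX : ClassX4Gord W 3) (hsurj : Surj W 3) (hcert : BranchUnitCertificateAt W 3)
    {κ : ZpExtension ℚ 3} {γ : Field.absoluteGaloisGroup ℚ}
    (hκ : κ.IsCyclotomic) (hγ : κ.IsTopGenerator γ) (hγ' : IsCyclotomicVariable 3 γ)
    (D : W.SelmerDualData κ γ) {fE : IwasawaAlgebra 3} (hchar : D.charIdeal = Ideal.span {fE}) :
    D.IsTorsion ∧ mu fE = 0 ∧ lam fE ≤ 1 :=
  hX.isTorsion_and_mu_zero_lam_le_one_of_katoHalf_of_cert_oddPrime hK hmodD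
    (semistabilityIndex_eq_two_of_typeG_three W hX.typeGOrd.typeG hX.addv.2) hsurj hcert hκ hγ hγ' D
    hchar

/-! ### §2 `r_an = 1`: Schneider PROVED, the exact identity, and `BSD(E,3) ⟺ ord₃ q + ord₃ Reg₃ = 1` -/

/-- **O7-ord@3 ∩ X4♯(G-ord) ∩ surj(3), `r_an = 1`: for EVERY (B)-datum `Dh`, Schneider's
`Reg₃(E,Dh) ≠ 0` (PROVED) and the exact identity `ord₃ #Ш(E) + ord₃ Reg₃(E,Dh) + ord₃ ∏c_ℓ + ord₃ ℓ =
1 + 2·ord₃ #E(ℚ)_tors`** (`ℓ ∣ 9`, `= 1` off the anomalous rows; `Ш(E)` finite by GZK) — additive-p2's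
cell-agnostic core `schneider_and_padicVal_identity_rankOne_of_mu_zero_lam_le_one` over §1.
[cite: Delbourgo2002, Theorem (B) (p. 40)] [cite: Kato2004Asterisque, Thm. 17.4 (3) (p. 273)]
[cite: Washington1997, §7.1] -/
theorem ClassX4Gord.schneider_and_padicVal_identity_three_of_katoHalf_of_cert
    (hK : Wuthrich2014.kato_halfEigenCharIdeal_dvd_cyclotomicPrime_of_surjective)
    (hmodD : nonempty_modularParametrizationData)
    (hGZK : rank_eq_analyticRank_of_analyticRank_le_one)
    (hX : ClassX4Gord W 3) (hsurj : Surj W 3) (hr : W.analyticRank = 1)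
    (hcert : BranchUnitCertificateAt W 3) {Dh : PAdicHeightData W 3} (hB : LeadingTermClauses W 3 Dh) :
    SchneiderConjecture Dh ∧
      ∃ ℓ : ℕ, ℓ ∣ 3 ^ 2 ∧ (ReductionNonAnomalous W 3 → ℓ = 1) ∧
        (padicValNat 3 W.shaOrder : ℤ) + (padicRegulator Dh).valuation +
            padicValNat 3 W.tamagawaProduct + padicValNat 3 ℓ = 1 + 2 * padicValNat 3 W.torsionOrder := by
  obtain ⟨hmw, hfinSha⟩ := hGZK W (by rw [hr])
  have hr1 : W.mordellWeilRank = 1 := by rw [hmw, hr]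
  haveI : Finite W.sha := hfinSha
  obtain ⟨hS, -, ℓ, hℓp, hℓ1, hid⟩ :=
    schneider_and_padicVal_identity_rankOne_of_mu_zero_lam_le_one (W := W) (p := 3) (by decide) hr1 hB
      fun κ γ hκ hγ hγ' D fE hchar ↦
        hX.isTorsion_and_mu_zero_lam_le_one_three_of_katoHalf_of_cert hK hmodD hsurj hcert hκ hγ hγ' D
          hchar
  refine ⟨hS, ℓ, hℓp, hℓ1, ?_⟩
  rw [padicValNat_card_addPrimaryComponent] at hid
  exact hid

/-- **X3♯(G-ord)@3, `r_an = 1`: Schneider PROVED for every (B)-datum and the exact `3`-adic identity**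
(Wuthrich 2014 Thm. 16 `hWu`, additive-p2's odd-`p` X3 class theorem; defect `2` automatic).
[cite: Delbourgo2002, Theorem (B) (p. 40)] [cite: Wuthrich2014, Thm. 16 (p. 397)] -/
theorem ClassX3Gord.schneider_and_padicVal_identity_three_of_wuthrichHalf_of_cert
    (hWu : Wuthrich2014.thm16_halfEigenCharIdeal_dvd_cyclotomicPrime)
    (hmodD : nonempty_modularParametrizationData)
    (hGZK : rank_eq_analyticRank_of_analyticRank_le_one)
    (hX : ClassX3Gord W 3) (hr : W.analyticRank = 1)
    (hcert : BranchUnitCertificateAt W 3) {Dh : PAdicHeightData W 3} (hB : LeadingTermClauses W 3 Dh) :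
    SchneiderConjecture Dh ∧
      ∃ ℓ : ℕ, ℓ ∣ 3 ^ 2 ∧ (ReductionNonAnomalous W 3 → ℓ = 1) ∧
        (padicValNat 3 W.shaOrder : ℤ) + (padicRegulator Dh).valuation +
            padicValNat 3 W.tamagawaProduct + padicValNat 3 ℓ = 1 + 2 * padicValNat 3 W.torsionOrder := by
  obtain ⟨hmw, hfinSha⟩ := hGZK W (by rw [hr])
  have hr1 : W.mordellWeilRank = 1 := by rw [hmw, hr]
  haveI : Finite W.sha := hfinSha
  obtain ⟨hS, -, ℓ, hℓp, hℓ1, hid⟩ :=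
    schneider_and_padicVal_identity_rankOne_of_mu_zero_lam_le_one (W := W) (p := 3) (by decide) hr1 hB
      fun κ γ hκ hγ hγ' D fE hchar ↦
        hX.isTorsion_and_mu_zero_lam_le_one_of_wuthrichHalf_of_cert hWu hmodD (by decide)
          (semistabilityIndex_eq_two_of_typeG_three W hX.typeGOrd.typeG hX.addv) hcert hκ hγ hγ' D hchar
  refine ⟨hS, ℓ, hℓp, hℓ1, ?_⟩
  rw [padicValNat_card_addPrimaryComponent] at hid
  exact hid

/-- **O7-ord@3 ∩ X4♯(G-ord) ∩ surj(3), `r_an = 1`, NON-ANOMALOUS: `BSD(E,3) ⟺ ord₃ q + ord₃ Reg₃(E,Dh) = 1`**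
for every (B)-datum `Dh` (in particular Delbourgo's `⟨,⟩_{3,ℚ}`), where `L'(E,1) = q·Ω_E·Reg_∞(E)` —
given Kato's divisibility and the one-number certificate; `Ш` has left the statement (additive-p2's
bookkeeping `bsdp_iff_padicValRat_add_eq_one`). NO `hPal`, NO `he`, NO tower binder.
[cite: Delbourgo2002, Theorem (B) (p. 40)] [cite: Kato2004Asterisque, Thm. 17.4 (3) (p. 273)]
[cite: Miller2011LMS, Def. 1.1] -/
theorem ClassX4Gord.bsdp_three_iff_padicVal_rankOne_of_katoHalf_of_cert
    (hK : Wuthrich2014.kato_halfEigenCharIdeal_dvd_cyclotomicPrime_of_surjective)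
    (hmodD : nonempty_modularParametrizationData)
    (hGZK : rank_eq_analyticRank_of_analyticRank_le_one) (hmod : hasEntireLFunction_rat)
    (hX : ClassX4Gord W 3) (hsurj : Surj W 3) (hr : W.analyticRank = 1)
    (hna : ReductionNonAnomalous W 3) (hcert : BranchUnitCertificateAt W 3)
    {Dh : PAdicHeightData W 3} (hB : LeadingTermClauses W 3 Dh)
    {q : ℚ} (hLq : W.leadingLCoeff = (q : ℂ) * (W.realPeriodRat : ℂ) * (W.regulator : ℂ)) :
    BSDp W 3 ↔ padicValRat 3 q + (padicRegulator Dh).valuation = 1 := by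
  obtain ⟨-, ℓ, -, hℓ1, hid⟩ :=
    hX.schneider_and_padicVal_identity_three_of_katoHalf_of_cert hK hmodD hGZK hsurj hr hcert hB
  rw [hℓ1 hna, padicValNat_one_right, Nat.cast_zero, add_zero] at hid
  have hq0 : q ≠ 0 := by
    rintro rfl
    rw [Rat.cast_zero, zero_mul, zero_mul] at hLq
    exact W.leadingLCoeff_ne_zero_holds (hmod W) hLq
  exact bsdp_iff_padicValRat_add_eq_one (W := W) (p := 3) hGZK (by rw [hr]) hq0 hLq hid

/-- **X3♯(G-ord)@3, `r_an = 1`, non-anomalous: `BSD(E,3) ⟺ ord₃ q + ord₃ Reg₃(E,Dh) = 1`** for every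
(B)-datum, given Wuthrich's divisibility and the certificate.
[cite: Delbourgo2002, Theorem (B) (p. 40)] [cite: Wuthrich2014, Thm. 16 (p. 397)] [cite: Miller2011LMS, Def. 1.1] -/
theorem ClassX3Gord.bsdp_three_iff_padicVal_rankOne_of_wuthrichHalf_of_cert
    (hWu : Wuthrich2014.thm16_halfEigenCharIdeal_dvd_cyclotomicPrime)
    (hmodD : nonempty_modularParametrizationData)
    (hGZK : rank_eq_analyticRank_of_analyticRank_le_one) (hmod : hasEntireLFunction_rat)
    (hX : ClassX3Gord W 3) (hr : W.analyticRank = 1)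
    (hna : ReductionNonAnomalous W 3) (hcert : BranchUnitCertificateAt W 3)
    {Dh : PAdicHeightData W 3} (hB : LeadingTermClauses W 3 Dh)
    {q : ℚ} (hLq : W.leadingLCoeff = (q : ℂ) * (W.realPeriodRat : ℂ) * (W.regulator : ℂ)) :
    BSDp W 3 ↔ padicValRat 3 q + (padicRegulator Dh).valuation = 1 := by
  obtain ⟨-, ℓ, -, hℓ1, hid⟩ :=
    hX.schneider_and_padicVal_identity_three_of_wuthrichHalf_of_cert hWu hmodD hGZK hr hcert hB
  rw [hℓ1 hna, padicValNat_one_right, Nat.cast_zero, add_zero] at hid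
  have hq0 : q ≠ 0 := by
    rintro rfl
    rw [Rat.cast_zero, zero_mul, zero_mul] at hLq
    exact W.leadingLCoeff_ne_zero_holds (hmod W) hLq
  exact bsdp_iff_padicValRat_add_eq_one (W := W) (p := 3) hGZK (by rw [hr]) hq0 hLq hid

/-- **The (B)-datum SUPPLIED by Delbourgo 2002 at `3`** (`hDel3`, non-CM): on O7-ord@3 ∩ X4♯(G-ord) ∩
surj(3), `r_an = 1`, there IS a height datum `Dh` with the (B)-clauses, and it is non-degenerate.
[cite: Delbourgo2002, Theorem (A), (B) (p. 40)] -/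
theorem ClassX4Gord.exists_leadingTermClauses_and_schneider_three_of_katoHalf_of_cert
    (hDel3 : Delbourgo2002.mainTheorem_three)
    (hK : Wuthrich2014.kato_halfEigenCharIdeal_dvd_cyclotomicPrime_of_surjective)
    (hmodD : nonempty_modularParametrizationData)
    (hGZK : rank_eq_analyticRank_of_analyticRank_le_one)
    (hX : ClassX4Gord W 3) (hcm : ¬ W.HasCM) (hsurj : Surj W 3) (hr : W.analyticRank = 1)
    (hcert : BranchUnitCertificateAt W 3) :
    ∃ Dh : PAdicHeightData W 3, LeadingTermClauses W 3 Dh ∧ SchneiderConjecture Dh := by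
  obtain ⟨-, Dh, hB⟩ := TypeGOrd.delbourgo2002_three hDel3 hX.typeGOrd hX.addv.2 hcm
  exact ⟨Dh, hB,
    (hX.schneider_and_padicVal_identity_three_of_katoHalf_of_cert hK hmodD hGZK hsurj hr hcert hB).1⟩

end Three

/-! ### §3 The certificate from ONE number on the odd branch — no Pal input -/

section OddBranch

variable {W : WeierstrassCurve ℚ} [W.IsElliptic] [W.IsGloballyMinimal] {p : ℕ} [hp : Fact p.Prime]

/-- **`p ≡ 3 (mod 4)` (`p = 3` included): the constant-term half of the certificate is a THEOREM when
`L(E,1) = 0`, with NO Pal input** — the odd arm of additive-p2's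
`constantCoeff_branch_eq_zero_of_entireLFunction_one_eq_zero` (Birch's formula for the twist by
`−p < 0` is the tree theorem `entireLFunction_one_eq_of_twist_neg`; interpolation
`B⁻_{(p−1)/2}(0) = α⁻¹·∑_a (a/p)[a/p]⁻_f`). [cite: MazurTateTeitelbaum1986Invent, §I.13–I.14]
[cite: Pal2012, Thm. 3.2 (the d < 0 case, a tree theorem)] -/
theorem constantCoeff_branch_eq_zero_of_entireLFunction_one_eq_zero_odd
    (hmod : hasEntireLFunction_rat) (hp4 : p % 4 = 3) (hadd : Addv W p) (hL : W.entireLFunction 1 = 0)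
    (V : WeierstrassCurve ℚ) [V.IsElliptic] [V.IsGloballyMinimal] (C : VariableChange ℚ)
    (hC : C • V.quadraticTwist ((-1 : ℚ) ^ (p / 2) * p) = W) (hord : IsOrdinaryAt V p)
    {N : ℕ} [NeZero N] {f : CuspForm (Gamma0 N) 2} (hf : IsNewformOf V f)
    (ϖ : ℚ) (hϖ : if Even (p / 2) then (ϖ : ℝ) * V.realPeriodRat = plusPeriod f
      else (ϖ : ℝ) * V.imaginaryPeriodRat = minusPeriod f) :
    PowerSeries.constantCoeff (PowerSeries.C (ϖ : ℚ_[p]) *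
        (if Even (p / 2) then padicLFunctionBranch f ((unitRoot V p : ℤ_[p]) : ℚ_[p]) (p / 2)
          else padicLFunctionMinusBranch f ((unitRoot V p : ℤ_[p]) : ℚ_[p]) (p / 2))) = 0 := by
  have hp2 : p ≠ 2 := by omega
  have hΩ : (W.realPeriodRat : ℂ) ≠ 0 := by exact_mod_cast W.realPeriodRat_pos_holds.ne'
  have hnot : ¬ Even (p / 2) := by rw [Nat.not_even_iff_odd]; exact ⟨p / 4, by omega⟩
  have hC' : C • V.quadraticTwist (-(p : ℚ)) = W := by
    rw [pStar_eq_of_mod_four p (Or.inr hp4), if_neg (by omega)] at hC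
    exact hC
  rw [if_neg hnot] at hϖ
  rw [if_neg hnot, map_mul, PowerSeries.constantCoeff_C,
    constantCoeff_padicLFunctionMinusBranch_half p hp2 V hord hf]
  obtain ⟨ε, hε, hLq⟩ := entireLFunction_one_eq_of_twist_neg p hmod hp4 V W C hC' hadd hf ϖ hϖ
  rw [hL] at hLq
  have hzero : ε * (ϖ * legendreMinusSymbolSum f p) /
      (|(C.u : ℚ)| * ((W.baseChange ℝ).numRealComponents : ℚ)) = 0 := by
    exact_mod_cast (mul_eq_zero.mp hLq.symm).resolve_right hΩ
  have hε0 : ε ≠ 0 := by rcases hε with rfl | rfl <;> norm_num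
  have hua0 : |(C.u : ℚ)| ≠ 0 := abs_ne_zero.mpr C.u.ne_zero
  have hcinf0 : ((W.baseChange ℝ).numRealComponents : ℚ) ≠ 0 := by
    rw [numRealComponents]
    split_ifs <;> norm_num
  have hϖS : ϖ * legendreMinusSymbolSum f p = 0 := by
    rcases div_eq_zero_iff.mp hzero with h | h
    · exact (mul_eq_zero.mp h).resolve_left hε0
    · exact absurd h (mul_ne_zero hua0 hcinf0)
  have hϖS' : (ϖ : ℚ_[p]) * (legendreMinusSymbolSum f p : ℚ_[p]) = 0 := by exact_mod_cast hϖS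
  calc (ϖ : ℚ_[p]) * ((((unitRoot V p : ℤ_[p]) : ℚ_[p]))⁻¹ * (legendreMinusSymbolSum f p : ℚ_[p]))
      = (((unitRoot V p : ℤ_[p]) : ℚ_[p]))⁻¹ *
          ((ϖ : ℚ_[p]) * (legendreMinusSymbolSum f p : ℚ_[p])) := by ring
    _ = 0 := by rw [hϖS', mul_zero]

/-- **`p ≡ 3 (mod 4)`: the certificate from ONE number when `L(E,1) = 0`, with NO Pal input.**
[cite: MazurTateTeitelbaum1986Invent, §I.13–I.14] [cite: SteinWuthrich2013, §4 (shape of such certificates)] -/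
theorem branchUnitCertificateAt_of_norm_coeff_one_odd
    (hmod : hasEntireLFunction_rat) (hp4 : p % 4 = 3) (hadd : Addv W p) (hL : W.entireLFunction 1 = 0)
    (hone : ∀ (V : WeierstrassCurve ℚ) [V.IsElliptic] [V.IsGloballyMinimal] (C : VariableChange ℚ),
      C • V.quadraticTwist ((-1 : ℚ) ^ (p / 2) * p) = W → IsOrdinaryAt V p →
      ∀ {N : ℕ} [NeZero N] (f : CuspForm (Gamma0 N) 2), IsNewformOf V f →
      ∀ ϖ : ℚ, (if Even (p / 2) then (ϖ : ℝ) * V.realPeriodRat = plusPeriod f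
          else (ϖ : ℝ) * V.imaginaryPeriodRat = minusPeriod f) →
        ‖PowerSeries.coeff 1 (PowerSeries.C (ϖ : ℚ_[p]) *
            (if Even (p / 2) then padicLFunctionBranch f ((unitRoot V p : ℤ_[p]) : ℚ_[p]) (p / 2)
              else padicLFunctionMinusBranch f ((unitRoot V p : ℤ_[p]) : ℚ_[p]) (p / 2)))‖ = 1) :
    BranchUnitCertificateAt W p :=
  fun V _ _ C hC hord _ _ f hf ϖ hϖ ↦
    ⟨constantCoeff_branch_eq_zero_of_entireLFunction_one_eq_zero_odd hmod hp4 hadd hL V C hC hord hf ϖ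
      hϖ, hone V C hC hord f hf ϖ hϖ⟩

end OddBranch

/-! ### §4 HEADLINE at `p = 3`: `BSD(E,3)` ⟺ ONE valuation, given Kato's divisibility and ONE `3`-adic unit -/

section Headline

variable {W : WeierstrassCurve ℚ} [W.IsElliptic] [W.IsGloballyMinimal] [hp : Fact (Nat.Prime 3)]

/-- **HEADLINE (O7-ord@3 ∩ X4♯(G-ord) ∩ {`ρ̄_{E,3}` onto}, `r_an = 1`, non-anomalous):
`BSD(E,3) ⟺ ord₃ q + ord₃ Reg₃(E,Dh) = 1` for every (B)-datum `Dh`, GIVEN Kato's divisibility and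
ONE `3`-adic unit** — the linear coefficient of the Néron-normalised `ω¹`-branch of the
Mazur–Tate–Teitelbaum series of `E ⊗ χ_{−3}` (`hone`); all other inputs published (Kato 17.4 (3)
half-eigenspace reading `hK`, GZK, modularity) or kernel (p14's tower, Birch for `d = −3`). NO Pal.
[cite: Kato2004Asterisque, Thm. 17.4 (3) (p. 273)] [cite: Delbourgo2002, Theorem (B) (p. 40)]
[cite: Miller2011LMS, Def. 1.1] [cite: MazurTateTeitelbaum1986Invent, §I.13–I.14] -/
theorem ClassX4Gord.bsdp_three_iff_padicVal_rankOne_of_katoHalf_of_norm_coeff_one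
    (hK : Wuthrich2014.kato_halfEigenCharIdeal_dvd_cyclotomicPrime_of_surjective)
    (hmodD : nonempty_modularParametrizationData)
    (hGZK : rank_eq_analyticRank_of_analyticRank_le_one) (hmod : hasEntireLFunction_rat)
    (hX : ClassX4Gord W 3) (hsurj : Surj W 3) (hr : W.analyticRank = 1)
    (hna : ReductionNonAnomalous W 3)
    (hone : ∀ (V : WeierstrassCurve ℚ) [V.IsElliptic] [V.IsGloballyMinimal] (C : VariableChange ℚ),
      C • V.quadraticTwist ((-1 : ℚ) ^ (3 / 2) * (3 : ℕ)) = W → IsOrdinaryAt V 3 →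
      ∀ {N : ℕ} [NeZero N] (f : CuspForm (Gamma0 N) 2), IsNewformOf V f →
      ∀ ϖ : ℚ, (if Even (3 / 2) then (ϖ : ℝ) * V.realPeriodRat = plusPeriod f
          else (ϖ : ℝ) * V.imaginaryPeriodRat = minusPeriod f) →
        ‖PowerSeries.coeff 1 (PowerSeries.C (ϖ : ℚ_[3]) *
            (if Even (3 / 2) then padicLFunctionBranch f ((unitRoot V 3 : ℤ_[3]) : ℚ_[3]) (3 / 2)
              else padicLFunctionMinusBranch f ((unitRoot V 3 : ℤ_[3]) : ℚ_[3]) (3 / 2)))‖ = 1)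
    {Dh : PAdicHeightData W 3} (hB : LeadingTermClauses W 3 Dh)
    {q : ℚ} (hLq : W.leadingLCoeff = (q : ℂ) * (W.realPeriodRat : ℂ) * (W.regulator : ℂ)) :
    BSDp W 3 ↔ padicValRat 3 q + (padicRegulator Dh).valuation = 1 :=
  hX.bsdp_three_iff_padicVal_rankOne_of_katoHalf_of_cert hK hmodD hGZK hmod hsurj hr hna
    (branchUnitCertificateAt_of_norm_coeff_one_odd hmod (by decide) hX.addv.2
      (entireLFunction_one_eq_zero_of_analyticRank_ne_zero hmod (by rw [hr]; exact one_ne_zero)) hone)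
    hB hLq

/-- **HEADLINE, X3 twin (X3♯(G-ord)@3, `r_an = 1`, non-anomalous): `BSD(E,3) ⟺
ord₃ q + ord₃ Reg₃(E,Dh) = 1` given Wuthrich's divisibility and ONE `3`-adic unit.** NO Pal.
[cite: Wuthrich2014, Thm. 16 (p. 397)] [cite: Delbourgo2002, Theorem (B) (p. 40)]
[cite: Miller2011LMS, Def. 1.1] -/
theorem ClassX3Gord.bsdp_three_iff_padicVal_rankOne_of_wuthrichHalf_of_norm_coeff_one
    (hWu : Wuthrich2014.thm16_halfEigenCharIdeal_dvd_cyclotomicPrime)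
    (hmodD : nonempty_modularParametrizationData)
    (hGZK : rank_eq_analyticRank_of_analyticRank_le_one) (hmod : hasEntireLFunction_rat)
    (hX : ClassX3Gord W 3) (hr : W.analyticRank = 1) (hna : ReductionNonAnomalous W 3)
    (hone : ∀ (V : WeierstrassCurve ℚ) [V.IsElliptic] [V.IsGloballyMinimal] (C : VariableChange ℚ),
      C • V.quadraticTwist ((-1 : ℚ) ^ (3 / 2) * (3 : ℕ)) = W → IsOrdinaryAt V 3 →
      ∀ {N : ℕ} [NeZero N] (f : CuspForm (Gamma0 N) 2), IsNewformOf V f →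
      ∀ ϖ : ℚ, (if Even (3 / 2) then (ϖ : ℝ) * V.realPeriodRat = plusPeriod f
          else (ϖ : ℝ) * V.imaginaryPeriodRat = minusPeriod f) →
        ‖PowerSeries.coeff 1 (PowerSeries.C (ϖ : ℚ_[3]) *
            (if Even (3 / 2) then padicLFunctionBranch f ((unitRoot V 3 : ℤ_[3]) : ℚ_[3]) (3 / 2)
              else padicLFunctionMinusBranch f ((unitRoot V 3 : ℤ_[3]) : ℚ_[3]) (3 / 2)))‖ = 1)
    {Dh : PAdicHeightData W 3} (hB : LeadingTermClauses W 3 Dh)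
    {q : ℚ} (hLq : W.leadingLCoeff = (q : ℂ) * (W.realPeriodRat : ℂ) * (W.regulator : ℂ)) :
    BSDp W 3 ↔ padicValRat 3 q + (padicRegulator Dh).valuation = 1 :=
  hX.bsdp_three_iff_padicVal_rankOne_of_wuthrichHalf_of_cert hWu hmodD hGZK hmod hr hna
    (branchUnitCertificateAt_of_norm_coeff_one_odd hmod (by decide) hX.addv
      (entireLFunction_one_eq_zero_of_analyticRank_ne_zero hmod (by rw [hr]; exact one_ne_zero)) hone)
    hB hLq

end Headline

end Summit.BirchSwinnertonDyer.Rank1Residual.Additive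

end
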